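import Summits.BirchSwinnertonDyer.Rank1Residual.X2.GreenbergVatsalReductionDatum
import Summits.BirchSwinnertonDyer.Rank1Residual.X1.SpectralNormTransport
import Summits.BirchSwinnertonDyer.Rank1Residual.Additive.LocalSubgroupTransport
import Literature.NumberTheory.EllipticCurves.ZpExtension
import HarnessLib

/-!
# LP-C (points): transport of "reduces to `Õ`" along the factorisation isomorphism
# `ι₂ : \bar ℚ_v ≃ \bar L_w` (cell `b2b-bsdres`, unit `b2b-bsdres-eisenstein-p1`, gen 20;
# X1R0-GAPMAP §28.4 (LP-C), §29)

HONEST FRAMING (run/shared/lean/b2b/bsd-rank1-residual/, verbatim in every file): the goal of the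
cell is to DELETE the COMBINATION-SHAPED residual classes of the Birch–Swinnerton-Dyer formula for
ALL analytic-rank `≤ 1` elliptic curves over `ℚ` — "full BSD formula for every rank `≤ 1` curve in
class `C`" assembled STRICTLY from published theorems — so that the rank-`≤ 1` remainder becomes
exactly the CONSTRUCTION-SHAPED classes, which are TYPED (missing-input `Prop`s), NOT attempted.
This is not "finishing BSD". Sub-cell `b2b-bsdres-eisenstein-p1`: research route; NO CLAIM BEYOND
STATED CLASSES; nothing here changes a label; nothing is booked. THEOREMS ONLY — no definition, no
named fact; the factorisation data `(ι₂, ι')` are HYPOTHESES (n1011's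
`Additive/LocalSubgroupTransport` shape), as is the `L_w`-side reduction datum `(red, hred)`
(`X1/LocalReductionStrict` shape).

## What and why

The local package (`X1/LocalStrictPackage`) is stated at the completion `L_w` of `L = ℚ_n` with the
reduction `red` of `E(\bar L_w)` for the spectral valuation of `\bar L_w`; FILE 24b
(`X1/GeneratorCountLayerAtPStrict`) asks strictness for X2's reduction `localRed` of `E(\bar ℚ_v)`.
The two are related through the factorisation isomorphism `ι₂ : \bar ℚ_v ≃+* \bar L_w` over
`ℚ_v → L_w` and `ι' = ι₂ ∘ ι ∘ ι_L⁻¹ : \bar L → \bar L_w` (n1011): n1011's `transportPoints`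
(`= (ι₂⁻¹)_*`) carries `(ι')_* (β P)` to `ι_* P` (`transportPoints_pointsMapOfEmb`), and `ι₂`
identifies the valuation rings (`X1/SpectralNormTransport`). Hence

* `red_eq_zero_iff_localRed_transportPoints_eq_zero` — **`red P' = Õ ↔ localRed ((ι₂⁻¹)_* P') = Õ`**
  for every `P' ∈ E(\bar L_w)` (both mean: `P' = O` or its abscissa is not integral);
* `red_pointsMapOfEmb_eq_zero_iff` — **`red ((ι')_* (β P)) = Õ ↔ localRed (ι_* P) = Õ`** for
  `P ∈ E[p^∞](\bar ℚ)`, `β = primaryBaseChangeEquiv`, `ι = closureEmb ℚ_v` — the exact shape of the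
  strictness clause of FILE 24b.

References: [SilvermanAEC2009] VII.§2; [SerreGaloisCohomology1997] II.§1.1; [NeukirchANT1999] II (4.8).
-/

noncomputable section

open scoped Classical NNReal

open Function Field NumberField IsDedekindDomain WeierstrassCurve
  Literature.NumberTheory.EllipticCurves Literature.NumberTheory.GaloisRepresentations
  IsDedekindDomain.HeightOneSpectrum
  Summit.BirchSwinnertonDyer.Rank1Residual.Additive.LocalTransport
  Summit.BirchSwinnertonDyer.Rank1Residual.X2.GreenbergVatsalReductionDatum

set_option autoImplicit false

namespace Summit.BirchSwinnertonDyer.Rank1Residual.X1.LocalPackageTransportPoints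

variable (W : WeierstrassCurve ℚ) [W.IsGloballyMinimal] (p : ℕ) [hp : Fact p.Prime]
  {v : HeightOneSpectrum (𝓞 ℚ)} (hpv : ((p : ℕ) : 𝓞 ℚ) ∈ v.asIdeal)
  (hΔ : ¬ (p : ℤ) ∣ minimalDiscriminantInt W)
  (L : Type) [Field L] [NumberField L]
  (wp : HeightOneSpectrum (𝓞 L)) [wp.asIdeal.LiesOver v.asIdeal]
  -- the `L_w`-side reduction datum (`X1/LocalReductionStrict` shape)
  {w' : Valuation (AlgebraicClosure (wp.adicCompletion L)) ℝ≥0}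
  (hw' : ∀ x, (w' x : ℝ) =
    spectralNorm (wp.adicCompletion L) (AlgebraicClosure (wp.adicCompletion L)) x)
  {M' : WeierstrassCurve ↥w'.valuationSubring}
  (hMK' : M'.baseChange (AlgebraicClosure (wp.adicCompletion L)) =
    (W.baseChange L).baseChange (AlgebraicClosure (wp.adicCompletion L)))
  {red : localPoints (W.baseChange L) (wp.adicCompletion L) →+
    (M'.map (IsLocalRing.residue ↥w'.valuationSubring)).toAffine.Point}
  (hred : ∀ P, red P = M'.reducePoint (Affine.Point.congrEquiv hMK'.symm P))
  -- the factorisation data (n1011 shape)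
  (ι₂ : AlgebraicClosure (v.adicCompletion ℚ) ≃+* AlgebraicClosure (wp.adicCompletion L))
  (hι₂ : ∀ x : v.adicCompletion ℚ,
    ι₂ (algebraMap (v.adicCompletion ℚ) (AlgebraicClosure (v.adicCompletion ℚ)) x) =
      algebraMap (wp.adicCompletion L) (AlgebraicClosure (wp.adicCompletion L))
        (adicCompletionMap (K := ℚ) L v wp x))
  (ι' : AlgebraicClosure L →ₐ[L] AlgebraicClosure (wp.adicCompletion L))
  (hcompat : ∀ z : AlgebraicClosure ℚ,
    ι' (closureEmb (K := ℚ) L z) = ι₂ (closureEmb (K := ℚ) (v.adicCompletion ℚ) z))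

/-! ## §1. `red P' = Õ ↔ localRed ((ι₂⁻¹)_* P') = Õ` -/

include hpv hw' hred hι₂ in
/-- **Transport of "reduces to `Õ`" along `ι₂`.** For `P' ∈ E(\bar L_w)`:
`red P' = Õ ↔ localRed_v ((ι₂⁻¹)_* P') = Õ` — both say "`P' = O` or the abscissa of `P'` is not
integral", and `ι₂⁻¹` identifies the valuation rings of the spectral valuations
(`X1/SpectralNormTransport.spectralNorm_ringEquiv_le_one_iff`). [cite: SilvermanAEC2009, VII.§2]
[cite: NeukirchANT1999, Ch. II (4.8)] -/
theorem red_eq_zero_iff_localRed_transportPoints_eq_zero (hΔ' : IsUnit M'.Δ)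
    (P' : localPoints (W.baseChange L) (wp.adicCompletion L)) :
    red P' = 0 ↔
      localRed W p hpv hΔ (transportPoints L (closureEmb (K := ℚ) (v.adicCompletion ℚ)) ι₂ ι'
        hcompat W P') = 0 := by
  have hvO' : w'.Integers w'.valuationSubring := Valuation.valuationSubring.integers w'
  have hvO : (specVal v).Integers (specVal v).valuationSubring :=
    Valuation.valuationSubring.integers (specVal v)
  have hΔv := W.isUnit_Δ_localIntModel hpv (specVal_spec v) hΔ
  rw [hred, ← goodReductionHom_apply hvO' hΔ', goodReductionHom_eq_zero_iff, localRed_apply,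
    ← goodReductionHom_apply hvO hΔv, goodReductionHom_eq_zero_iff]
  rcases P' with _ | ⟨x, y, h⟩
  · -- `P' = O`
    rw [← Affine.Point.zero_def, map_zero]
    change M'.ReducesToZero 0 ↔ _root_.WeierstrassCurve.ReducesToZero _
      (Affine.Point.congrEquiv (W.localIntModel_baseChange (specVal v).valuationSubring).symm
        (transportPoints L (closureEmb (K := ℚ) (v.adicCompletion ℚ)) ι₂ ι' hcompat W
          (0 : localPoints (W.baseChange L) (wp.adicCompletion L))))
    rw [map_zero]
    refine iff_of_true WeierstrassCurve.reducesToZero_zero ?_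
    change _root_.WeierstrassCurve.ReducesToZero _
      (Affine.Point.congrEquiv (W.localIntModel_baseChange (specVal v).valuationSubring).symm
        (0 : (W.baseChange (AlgebraicClosure (v.adicCompletion ℚ))).toAffine.Point))
    rw [map_zero]
    exact WeierstrassCurve.reducesToZero_zero
  · -- `P' = (x, y)`: the transported point is `(ι₂⁻¹ x, ι₂⁻¹ y)`
    have hsymm : (pointsCongr W L (AlgebraicClosure (wp.adicCompletion L))).symm
        (Affine.Point.some x y h) =
        Affine.Point.some x y ((baseChange_baseChange W L
          (AlgebraicClosure (wp.adicCompletion L))).symm ▸ h) := by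
      rw [AddEquiv.symm_apply_eq]
      exact (Affine.Point.congrEquiv_some _ _).symm
    rw [transportPoints_apply]
    change _ ↔ _root_.WeierstrassCurve.ReducesToZero _
      (Affine.Point.congrEquiv (W.localIntModel_baseChange (specVal v).valuationSubring).symm
        (Affine.Point.map _ ((pointsCongr W L (AlgebraicClosure (wp.adicCompletion L))).symm
          (Affine.Point.some x y h))))
    rw [hsymm, Affine.Point.map_some, Affine.Point.congrEquiv_some, Affine.Point.congrEquiv_some,
      WeierstrassCurve.reducesToZero_some_iff, WeierstrassCurve.reducesToZero_some_iff]
    change x ∉ _ ↔ ι₂.symm x ∉ _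
    -- integrality of the abscissa on both sides
    have hL : x ∈ Set.range (algebraMap ↥w'.valuationSubring (AlgebraicClosure (wp.adicCompletion L)))
        ↔ spectralNorm (wp.adicCompletion L) (AlgebraicClosure (wp.adicCompletion L)) x ≤ 1 := by
      rw [show Set.range (algebraMap ↥w'.valuationSubring (AlgebraicClosure (wp.adicCompletion L))) =
          (w'.valuationSubring : Set _) from Subtype.range_coe, SetLike.mem_coe,
        Valuation.mem_valuationSubring_iff, ← NNReal.coe_le_coe, hw', NNReal.coe_one]
    have hQ : ι₂.symm x ∈
        Set.range (algebraMap ↥(specVal v).valuationSubring (AlgebraicClosure (v.adicCompletion ℚ)))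
        ↔ spectralNorm (v.adicCompletion ℚ) (AlgebraicClosure (v.adicCompletion ℚ)) (ι₂.symm x)
          ≤ 1 := by
      rw [show Set.range (algebraMap ↥(specVal v).valuationSubring
          (AlgebraicClosure (v.adicCompletion ℚ))) = ((specVal v).valuationSubring : Set _) from
          Subtype.range_coe, SetLike.mem_coe, Valuation.mem_valuationSubring_iff,
        ← NNReal.coe_le_coe, specVal_spec, NNReal.coe_one]
    rw [not_iff_not, hL, hQ, ← SpectralNormTransport.spectralNorm_ringEquiv_le_one_iff L v wp ι₂ hι₂
      (ι₂.symm x), RingEquiv.apply_symm_apply]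

/-! ## §2. The strictness shape of FILE 24b -/

include hpv hw' hred hι₂ hcompat in
/-- **`red ((ι')_* (β P)) = Õ ↔ localRed (ι_* P) = Õ`** for `P ∈ E[p^∞](\bar ℚ)`
(`β = primaryBaseChangeEquiv L W p`, `ι = closureEmb ℚ_v`): §1 and n1011's coefficient identity
`(ι₂⁻¹)_* ((ι')_* (β P)) = ι_* P` (`transportPoints_pointsMapOfEmb`). This is the clause of
`X1/GeneratorCountLayerAtPStrict`'s `hstrict`, read on the `L_w` side.
[cite: SerreGaloisCohomology1997, II.§1.1] [cite: SilvermanAEC2009, VII.§2] -/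
theorem red_pointsMapOfEmb_eq_zero_iff (hΔ' : IsUnit M'.Δ) (P : W.geomPrimaryTorsion p) :
    red (pointsMapOfEmb (W.baseChange L) ι'
        ((primaryBaseChangeEquiv L W p P : (W.baseChange L).geomPrimaryTorsion p) :
          WeierstrassCurve.geomPoints (W.baseChange L))) = 0 ↔
      localRed W p hpv hΔ (pointsMap W (v.adicCompletion ℚ) (P : W.geomPoints)) = 0 := by
  rw [red_eq_zero_iff_localRed_transportPoints_eq_zero W p hpv hΔ L wp hw' hMK' hred ι₂ hι₂ ι'
    hcompat hΔ', transportPoints_pointsMapOfEmb]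
  rfl

end Summit.BirchSwinnertonDyer.Rank1Residual.X1.LocalPackageTransportPoints

end
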